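import Summits.AnomalousDissipation.AnomalousDissipation.Theorems.ImpulseGridGridSignsCoherentTransfer
import Literature.Analysis.FunctionSpaces.TorusFluidGlueProofs
import Literature.Analysis.FunctionSpaces.TorusCalculusProofs

/-!
# Crux `GridSigns` (stmt-AnomalousDissipation-1771) — imprint subtraction

Helper for the crux `GridSigns` of route ImpulseGrid (line `Sketch`, card
`imprint-subtraction-production-signs`, item 2): subtracting the frozen Euler wake `c⁻¹Ψ•G`
from the fluctuation `w`, the Reynolds-stress work against the imprint `Ψ•G` splits as
`∫⟪w,(w·∇)(ΨG)⟫ = ∫⟪v,(v·∇)(ΨG)⟫ + c⁻¹∫Ψ²⟪v,(G·∇)G⟫`, `v := w − c⁻¹Ψ•G`, for every smooth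
divergence-free `w` (`imprintSubtraction`). Pointwise `((ΨG)·∇)(ΨG) = Ψ²(G·∇)G`, because
`G·∇Ψ = 0` for the grid design (`G₀ = 0`, `∂₁Ψ = ∂₂Ψ = 0`); after expanding by bilinearity the
only surviving cross term `∫⟪ΨG,(w·∇)(ΨG)⟫` vanishes by the antisymmetry of the trilinear form
(`Torus.integral_inner_convect_add_eq_zero`, `div w = 0`). All fields are smooth on the compact
torus, so every integrand is integrable.
-/

noncomputable section

-- `Summit.<Summit>.<Problem>` is the tree's mandated summit-side namespace (CONVENTIONS §2); for this
-- single-conjunct summit the two coincide, so the duplicate is deliberate.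
set_option linter.dupNamespace false

open MeasureTheory Set Filter Topology
open scoped InnerProductSpace RealInnerProductSpace

namespace Summit.AnomalousDissipation.AnomalousDissipation.Theorems.ImpulseGridGridSigns

open Literature.Analysis
open Literature.Analysis.FluidPDE
open Literature.Analysis.FunctionSpaces Literature.Analysis.FunctionSpaces.Torus
open Summit.AnomalousDissipation.AnomalousDissipation.Theses.ImpulseGrid

/-! ### Pointwise algebra of the grid design -/

section Design

variable {Ψ : UnitAddTorus (Fin 3) → ℝ} {G : UnitAddTorus (Fin 3) → EuclideanSpace ℝ (Fin 3)}

/-- `G·∇Ψ = 0` for the grid design: `DΨ(x)[G x] = ∑ᵢ Gᵢ(x) ∂ᵢΨ(x) = 0` since `G₀ = 0` and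
`∂₁Ψ = ∂₂Ψ = 0` (`Ψ` is invariant under translations in the coordinates `1` and `2`). [folklore] -/
theorem fderiv_sawtooth_apply_eq_zero (hΨ : IsSmooth Ψ)
    (hΨinv : ∀ (s : UnitAddCircle) (x : UnitAddTorus (Fin 3)),
      Ψ (x + Pi.single (1 : Fin 3) s) = Ψ x ∧ Ψ (x + Pi.single (2 : Fin 3) s) = Ψ x)
    (hG0 : ∀ x, G x 0 = 0) (x : UnitAddTorus (Fin 3)) :
    Torus.fderiv Ψ x (G x) = 0 := by
  have h1 : partialDeriv 1 Ψ x = 0 :=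
    GridInjection.partialDeriv_eq_zero_of_forall_add_single (fun s y => (hΨinv s y).1) x
  have h2 : partialDeriv 2 Ψ x = 0 :=
    GridInjection.partialDeriv_eq_zero_of_forall_add_single (fun s y => (hΨinv s y).2) x
  rw [fderiv_apply_eq_sum_partialDeriv (hΨ.isContDiff (by simp)), Fin.sum_univ_three, hG0 x,
    h1, h2]
  simp

/-- For the grid design, `D(Ψ•G)(x)[G x] = Ψ(x) • DG(x)[G x]`, i.e. `(G·∇)(Ψ•G) = Ψ•(G·∇)G`
(Leibniz rule and `G·∇Ψ = 0`). [folklore] -/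
theorem fderiv_smul_apply_design (hΨ : IsSmooth Ψ) (hG : IsSmooth G)
    (hΨinv : ∀ (s : UnitAddCircle) (x : UnitAddTorus (Fin 3)),
      Ψ (x + Pi.single (1 : Fin 3) s) = Ψ x ∧ Ψ (x + Pi.single (2 : Fin 3) s) = Ψ x)
    (hG0 : ∀ x, G x 0 = 0) (x : UnitAddTorus (Fin 3)) :
    Torus.fderiv (fun y => Ψ y • G y) x (G x) = Ψ x • Torus.fderiv G x (G x) := by
  rw [Literature.Analysis.FunctionSpaces.Torus.fderiv_smul_apply (hΨ.isContDiff (by simp))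
    (hG.isContDiff (by simp)), fderiv_sawtooth_apply_eq_zero hΨ hΨinv hG0 x, zero_smul, add_zero]

end Design

/-! ### Imprint subtraction -/

/-- **Imprint subtraction** (card `imprint-subtraction-production-signs`, item 2). For the grid
design (`Ψ` smooth and `x₁,x₂`-invariant, `G` smooth, `x₀`-invariant, transverse `G₀ = 0`,
divergence free), any `c ≠ 0` and any smooth divergence-free fluctuation `w`, with the frozen
Euler wake subtracted, `v := w − c⁻¹Ψ•G`:
`∫⟪w,(w·∇)(Ψ•G)⟫ = ∫⟪v,(v·∇)(Ψ•G)⟫ + c⁻¹∫Ψ²⟪v,(G·∇)G⟫`.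
Proof: expand `w = v + c⁻¹Ψ•G` by bilinearity of `(u·∇)V = DV[u]`; `((Ψ•G)·∇)(Ψ•G) = Ψ²(G·∇)G`
pointwise (`fderiv_smul_apply_design`); the cross term `∫⟪Ψ•G,(w·∇)(Ψ•G)⟫` vanishes by
antisymmetry of the trilinear form for the divergence-free `w`
(`Torus.integral_inner_convect_add_eq_zero`). [folklore] -/
theorem imprintSubtraction :
    ∀ (Ψ : UnitAddTorus (Fin 3) → ℝ) (G w : UnitAddTorus (Fin 3) → EuclideanSpace ℝ (Fin 3)) (c : ℝ), c ≠ 0 → IsSmooth Ψ → IsSmooth G → IsSmooth w → (∀ (s : UnitAddCircle) x, Ψ (x + Pi.single (1 : Fin 3) s) = Ψ x ∧ Ψ (x + Pi.single (2 : Fin 3) s) = Ψ x) → (∀ (s : UnitAddCircle) x, G (x + Pi.single (0 : Fin 3) s) = G x) → (∀ x, G x 0 = 0) → IsDivFree G → IsDivFree w → ∫ x, ⟪w x, Torus.convect w (fun y => Ψ y • G y) x⟫ = (∫ x, ⟪w x - c⁻¹ • Ψ x • G x, Torus.convect (fun y => w y - c⁻¹ • Ψ y • G y) (fun y => Ψ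 y • G y) x⟫) + c⁻¹ * ∫ x, (Ψ x) ^ 2 * ⟪w x - c⁻¹ • Ψ x • G x, Torus.convect G G x⟫ := by
  intro Ψ G w c _hc hΨ hG hw hΨinv _hGinv hG0 _hGdiv hwdiv
  -- smoothness bookkeeping
  have hV : IsSmooth (fun y => Ψ y • G y) := hΨ.smul' hG
  have hv : IsSmooth (fun y => w y - c⁻¹ • Ψ y • G y) := hw.sub (hV.smul c⁻¹)
  -- the pointwise expansion
  have hP : ∀ x, Torus.fderiv (fun y => Ψ y • G y) x (G x) = Ψ x • Torus.fderiv G x (G x) :=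
    fderiv_smul_apply_design hΨ hG hΨinv hG0
  have key : ∀ x, ⟪w x, Torus.convect w (fun y => Ψ y • G y) x⟫ =
      ⟪w x - c⁻¹ • Ψ x • G x,
          Torus.convect (fun y => w y - c⁻¹ • Ψ y • G y) (fun y => Ψ y • G y) x⟫ +
        (c⁻¹ * ((Ψ x) ^ 2 * ⟪w x - c⁻¹ • Ψ x • G x, Torus.convect G G x⟫) +
          c⁻¹ * ⟪Ψ x • G x, Torus.convect w (fun y => Ψ y • G y) x⟫) := by
    intro x
    simp only [Torus.convect, map_sub, map_smul, hP, inner_sub_left, inner_sub_right,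
      real_inner_smul_left, real_inner_smul_right]
    ring
  -- integrability of the three pieces (continuous integrands on the compact torus)
  have i1 : Integrable (fun x => ⟪w x - c⁻¹ • Ψ x • G x,
      Torus.convect (fun y => w y - c⁻¹ • Ψ y • G y) (fun y => Ψ y • G y) x⟫) volume :=
    (hv.inner (hv.convect hV)).integrable
  have i2 : Integrable
      (fun x => (Ψ x) ^ 2 * ⟪w x - c⁻¹ • Ψ x • G x, Torus.convect G G x⟫) volume :=
    ((hΨ.continuous.pow 2).mul (hv.inner (hG.convect hG)).continuous).integrable_unitAddTorus
  have i3 : Integrable (fun x => ⟪Ψ x • G x, Torus.convect w (fun y => Ψ y • G y) x⟫) volume :=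
    (hV.inner (hw.convect hV)).integrable
  have i23 : Integrable (fun x => c⁻¹ * ((Ψ x) ^ 2 * ⟪w x - c⁻¹ • Ψ x • G x, Torus.convect G G x⟫) +
      c⁻¹ * ⟪Ψ x • G x, Torus.convect w (fun y => Ψ y • G y) x⟫) volume :=
    (i2.const_mul _).add (i3.const_mul _)
  -- the cross term vanishes: antisymmetry of the trilinear form, `div w = 0`
  have h0 : ∫ x, ⟪Ψ x • G x, Torus.convect w (fun y => Ψ y • G y) x⟫ = 0 := by
    have h := Literature.Analysis.FunctionSpaces.Torus.integral_inner_convect_add_eq_zero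
      hw hwdiv hV hV
    have hcomm : (∫ x, ⟪Torus.convect w (fun y => Ψ y • G y) x, Ψ x • G x⟫) =
        ∫ x, ⟪Ψ x • G x, Torus.convect w (fun y => Ψ y • G y) x⟫ :=
      integral_congr_ae (ae_of_all _ fun x => real_inner_comm _ _)
    rw [hcomm] at h
    linarith
  have hL : (∫ x, ⟪w x, Torus.convect w (fun y => Ψ y • G y) x⟫) =
      ∫ x, (⟪w x - c⁻¹ • Ψ x • G x,
          Torus.convect (fun y => w y - c⁻¹ • Ψ y • G y) (fun y => Ψ y • G y) x⟫ +
        (c⁻¹ * ((Ψ x) ^ 2 * ⟪w x - c⁻¹ • Ψ x • G x, Torus.convect G G x⟫) +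
          c⁻¹ * ⟪Ψ x • G x, Torus.convect w (fun y => Ψ y • G y) x⟫)) :=
    integral_congr_ae (ae_of_all _ key)
  rw [hL, integral_add i1 i23,
    integral_add (i2.const_mul _) (i3.const_mul _), integral_const_mul, integral_const_mul, h0,
    mul_zero, add_zero]

end Summit.AnomalousDissipation.AnomalousDissipation.Theorems.ImpulseGridGridSigns

end
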